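import Summits.QuantumFields.GaugeBoot.ZdCentralTwistLimitPoints
import Summits.QuantumFields.GaugeBoot.CubicTorusWilsonLoopBetaFlip
import Literature.MathematicalPhysics.QuantumLattice.WilsonLoopsProofs
import HarnessLib

/-!
# The `ℤ^d` staggered central twist on rectangular Wilson loops: `W_{R×T} ↦ (-1)^{RT} W_{R×T}`,
# and even-side limit-point Wilson loop values at `-β` (gauge-boot, L3 structural supplement;
# `ℤ^d` twist 7)

HONEST FRAMING (cell `pub-gaugeboot`, page 1 of every file): the venture produces certified bounds
on lattice expectations at stated coupling, gauge group, dimension and torus size; NOT a mass gap,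
NOT a continuum limit, NOT a string tension; NOT Yang–Mills-summit-bearing (barriers
`FixedCouplingUltralocality`, `PerturbativeInvisibility`). This module bounds no expectation; no
certificate of the cell sits at `β < 0` (a mirror bound at `-β` obtained from a certified row at
`β` by the sign rule below is a COROLLARY of that row, not a new certificate, and only for
`SU(2)` / `U(N)`).

`CubicTorusWilsonLoopBetaFlip.lean` computed the action of the Kogut–Susskind twist on the torus
rectangle holonomy (`U_{R×T} ↦ z^{RT} U_{R×T}`, the area parity). Here the same for the tree's
`ℤ^d` Wilson loops (`Literature.MathematicalPhysics.QuantumLattice.WilsonLoops`: `walkHolonomy`,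
`lineWalk`, `rectWalk`, `wilsonLoopObs`), and the consequence for the class LIMIT of the cell's table
(even-side infinite-volume limit points, part 4 `ZdCentralTwistLimitPoints.lean`):

* `walkHolonomy_centralTwist_lineWalk` — a straight walk of `n` steps in direction `i` collects
  the weight `z^{n c(x,i)}` (the parity is constant along its own direction);
  ★ `walkHolonomy_centralTwist_rectWalk` — `hol_{R×T}(T U) = z^{RT} hol_{R×T}(U)` (`i ≠ j`);
  `wilsonLoopObs_centralTwist_rectWalk` — `W_{R×T}(T U) = (-1)^{RT} W_{R×T}(U)` for
  `χ = normalisedCharacter N ∘ ρ`, `ρ z = -1`;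
* ★★ `integral_wilsonLoopObs_rectWalk_map_centralTwist` — `∫ W_{R×T} d(μ ∘ T⁻¹) = (-1)^{RT} ∫ W_{R×T} dμ`
  (every measure);
* ★★★ `exists_limit_integral_wilsonLoopObs_rectWalk_neg` — **if `μ` is an even-side infinite-volume
  limit of the torus Wilson states at `β`, there is an even-side limit `ν` at `-β` along the same
  sequence (namely `μ ∘ T⁻¹`) with `∫ W_{R×T} dν = (-1)^{RT} ∫ W_{R×T} dμ` for all `R, T`, every
  plane and base point** — the infinite-volume form of `wilsonLoopExpectation_neg_of_even`; since
  `T` is an involution the correspondence is a bijection (`ZdCentralTwistLimitPoints`), so the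
  SET of limit-point values `{∫ W_{R×T} dν}` at `-β` is `(-1)^{RT}` times the set at `β`
  (`limitValues_wilsonLoop_neg`); `SU(2n)` and `U(N)` instances.

What is NOT claimed: nothing for odd sides or `SU(2n+1)`; non-rectangular loops (any contractible
loop picks up `z^{area parity}` — Stokes for the sign rule `dc = 1` — not typed here); no bound.
[folklore] bookkeeping (Li–Meurice 2005 §II; Kogut–Susskind 1975; Wilson 1974).
-/

noncomputable section

open MeasureTheory Filter Topology SimpleGraph
open Literature.Probability.LatticeModels (Site)
open Literature.MathematicalPhysics.QuantumLattice

namespace Summit.QuantumFields.GaugeBoot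

namespace TiltedRP

variable {d N : ℕ} {G : Type*} [Group G]

/-! ## The twist on straight walks and rectangles of `ℤ^d` -/

section Walks

variable {z : G} {π : Fin d → Site d →+ ZMod 2}

/-- A forward dart holonomy under the twist: `(T U)_{(x,i)} = s(x,i) U_{(x,i)}`. -/
theorem dartHolonomy_centralTwist_add_single (s : ZdEdge d → G) (U : LGConfig d G) (x : Site d)
    (i : Fin d) :
    dartHolonomy (centralTwist s U) ⟨(x, x + Pi.single i 1), zdGraph_adj_add_single x i⟩ =
      s (x, i) * U (x, i) := by
  rw [dartHolonomy_add_single, centralTwist_apply]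

/-- **A straight walk collects the weight `z^{n c(x,i)}`**: the parity `c(·, i)` is constant along
the direction `i`, and the weights are central. -/
theorem walkHolonomy_centralTwist_lineWalk (hπ : IsDualParity (zdUnit d) π)
    (hzc : ∀ g : G, z * g = g * z) (hz2 : z * z = 1) (r i : Fin d) (U : LGConfig d G) :
    ∀ (n : ℕ) (x : Site d),
      walkHolonomy (centralTwist (stagTwist π r z) U) (lineWalk i n x) =
        zpow₂ z ((n : ZMod 2) * stagParity π r (x, i)) * walkHolonomy U (lineWalk i n x)
  | 0, x => by simp [lineWalk, zpow₂]
  | n + 1, x => by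
    have hzc' : ∀ (a : ZMod 2) (g : G), zpow₂ z a * g = g * zpow₂ z a := fun a g => by
      unfold zpow₂; split_ifs <;> simp [hzc]
    have hpar : stagParity π r (x + Pi.single i 1, i) = stagParity π r (x, i) := by
      have h := stagParity_add_e hπ r x i i
      rw [zdUnit_apply, if_neg (precLast_irrefl' r i), add_zero] at h
      exact h
    rw [lineWalk, walkHolonomy_cons, walkHolonomy_copy, walkHolonomy_cons, walkHolonomy_copy,
      walkHolonomy_centralTwist_lineWalk hπ hzc hz2 r i U n (x + Pi.single i 1),
      dartHolonomy_centralTwist_add_single, dartHolonomy_add_single, stagTwist, hpar]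
    rw [mul_assoc, ← mul_assoc (U (x, i)), ← hzc' _ (U (x, i)), mul_assoc, ← mul_assoc,
      ← zpow₂_add hz2]
    congr 2
    push_cast
    ring
where
  /-- `≺` is irreflexive (local copy, to keep this file independent of part 2). -/
  precLast_irrefl' (r a : Fin d) : ¬PrecLast r a a :=
    fun h => h.2.elim (fun h' => h.1 h') (lt_irrefl _)

/-- ★ **The rectangle holonomy under the twist: `hol_{R×T}(T U) = z^{RT} · hol_{R×T}(U)`** (`i ≠ j`;
the four sides contribute `z^{R c(x,i)} z^{T(c(x,j) + R[i≺j])} z^{R(c(x,i) + T[j≺i])} z^{T c(x,j)}` and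
exactly one of `i ≺ j`, `j ≺ i` holds — the area parity). -/
theorem walkHolonomy_centralTwist_rectWalk (hπ : IsDualParity (zdUnit d) π)
    (hzc : ∀ g : G, z * g = g * z) (hz2 : z * z = 1) (r : Fin d) (U : LGConfig d G) (x : Site d)
    {i j : Fin d} (hij : i ≠ j) (R T : ℕ) :
    walkHolonomy (centralTwist (stagTwist π r z) U) (rectWalk x i j R T) =
      zpow₂ z ((R * T : ℕ) : ZMod 2) * walkHolonomy U (rectWalk x i j R T) := by
  have hzc' : ∀ (a : ZMod 2) (g : G), zpow₂ z a * g = g * zpow₂ z a := fun a g => by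
    unfold zpow₂; split_ifs <;> simp [hzc]
  have hsq : ∀ a : ZMod 2, zpow₂ z a * zpow₂ z a = 1 := fun a => by
    unfold zpow₂; split_ifs <;> simp [hz2]
  have hline := walkHolonomy_centralTwist_lineWalk hπ hzc hz2 r
  simp only [rectWalk, walkHolonomy_append, walkHolonomy_copy, walkHolonomy_reverse, hline]
  -- the parities of the far sides
  have hRi : (x + Pi.single i (R : ℤ) : Site d) = x + R • zdUnit d i := by
    rw [zdUnit_apply, ← Pi.single_smul', nsmul_eq_mul, mul_one]
  have hTj : (x + Pi.single j (T : ℤ) : Site d) = x + T • zdUnit d j := by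
    rw [zdUnit_apply, ← Pi.single_smul', nsmul_eq_mul, mul_one]
  have hpj : stagParity π r (x + Pi.single i (R : ℤ), j) =
      stagParity π r (x, j) + R • (if PrecLast r i j then 1 else 0) := by
    rw [hRi, stagParity_add_nsmul_e hπ r x i j R]
  have hpi : stagParity π r (x + Pi.single j (T : ℤ), i) =
      stagParity π r (x, i) + T • (if PrecLast r j i then 1 else 0) := by
    rw [hTj, stagParity_add_nsmul_e hπ r x j i T]
  rw [hpj, hpi]
  -- collect the four central weights
  set A := walkHolonomy U (lineWalk i R x)
  set B := walkHolonomy U (lineWalk j T (x + Pi.single i (R : ℤ)))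
  set C := walkHolonomy U (lineWalk i R (x + Pi.single j (T : ℤ)))
  set D := walkHolonomy U (lineWalk j T x)
  have hIJ : ((if PrecLast r i j then (1 : ZMod 2) else 0) + if PrecLast r j i then 1 else 0) = 1 := by
    by_cases h : PrecLast r i j
    · rw [if_pos h, if_neg ((precLast_xor hij).1 h), add_zero]
    · rw [if_neg h, if_pos ((precLast_xor hij.symm).2 h), zero_add]
  have hassoc : ∀ p q u v A' B' C' D' : G,
      p * A' * (q * B' * ((u * C')⁻¹ * (v * D')⁻¹)) = p * A' * (q * B') * (u * C')⁻¹ * (v * D')⁻¹ :=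
    fun _ _ _ _ _ _ _ _ => by simp only [mul_assoc]
  have hassoc2 : ∀ A' B' C' D' : G, A' * B' * C'⁻¹ * D'⁻¹ = A' * (B' * (C'⁻¹ * D'⁻¹)) :=
    fun _ _ _ _ => by simp only [mul_assoc]
  rw [hassoc, twist_prod_four (hzc' _) (hzc' _) (hzc' _) (hsq _) (hsq _), ← zpow₂_add hz2,
    ← zpow₂_add hz2, ← zpow₂_add hz2, hassoc2]
  congr 2
  have h2 : (2 : ZMod 2) = 0 := by decide
  simp only [nsmul_eq_mul, Nat.cast_mul]
  linear_combination (↑R * ↑T : ZMod 2) * hIJ +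
    (↑R * stagParity π r (x, i) + ↑T * stagParity π r (x, j)) * h2

variable (ρ : G →* Matrix (Fin N) (Fin N) ℂ)

/-- **`W_{R×T}(T U) = (-1)^{RT} W_{R×T}(U)`** for the normalised-character Wilson loop observable of
the `ℤ^d` rectangle (`ρ z = -1`, `i ≠ j`). -/
theorem wilsonLoopObs_centralTwist_rectWalk (hπ : IsDualParity (zdUnit d) π)
    (hzc : ∀ g : G, z * g = g * z) (hz2 : z * z = 1) (hρz : ρ z = -1) (r : Fin d) (x : Site d)
    {i j : Fin d} (hij : i ≠ j) (R T : ℕ) (U : LGConfig d G) :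
    wilsonLoopObs (normalisedCharacter N ∘ ρ) (rectWalk x i j R T)
        (centralTwist (stagTwist π r z) U) =
      (-1 : ℝ) ^ (R * T) * wilsonLoopObs (normalisedCharacter N ∘ ρ) (rectWalk x i j R T) U := by
  simp only [wilsonLoopObs, Function.comp_apply, normalisedCharacter]
  rw [walkHolonomy_centralTwist_rectWalk hπ hzc hz2 r U x hij, map_mul, rep_zpow₂_natCast ρ hρz,
    smul_mul_assoc, one_mul, Matrix.trace_smul, Complex.smul_re, smul_eq_mul]
  ring

end Walks

/-! ## Measures and even-side limit points -/

section Limits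

variable [TopologicalSpace G] [IsTopologicalGroup G] [CompactSpace G] [MeasurableSpace G]
  [BorelSpace G] [SecondCountableTopology G]
variable (ρ : G →* Matrix (Fin N) (Fin N) ℂ) {z : G} {π : Fin d → Site d →+ ZMod 2}

omit [CompactSpace G] in
/-- ★★ **`∫ W_{R×T} d(μ ∘ T⁻¹) = (-1)^{RT} ∫ W_{R×T} dμ`** for every measure `μ` on `ℤ^d`
configurations (`ρ` continuous with `ρ z = -1`, `i ≠ j`). -/
theorem integral_wilsonLoopObs_rectWalk_map_centralTwist (hπ : IsDualParity (zdUnit d) π)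
    (hzc : ∀ g : G, z * g = g * z) (hz2 : z * z = 1) (hρ : Continuous ρ) (hρz : ρ z = -1)
    (r : Fin d) (μ : Measure (LGConfig d G)) (x : Site d) {i j : Fin d} (hij : i ≠ j) (R T : ℕ) :
    ∫ U, wilsonLoopObs (normalisedCharacter N ∘ ρ) (rectWalk x i j R T) U
        ∂(μ.map (centralTwist (stagTwist π r z))) =
      (-1 : ℝ) ^ (R * T) * ∫ U, wilsonLoopObs (normalisedCharacter N ∘ ρ) (rectWalk x i j R T) U ∂μ := by
  rw [integral_map_centralTwist _ μ (F := wilsonLoopObs (normalisedCharacter N ∘ ρ) (rectWalk x i j R T))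
    (continuous_wilsonLoopObs (continuous_normalisedCharacter_comp hρ) _), ← integral_const_mul]
  exact integral_congr_ae (ae_of_all _ fun U =>
    wilsonLoopObs_centralTwist_rectWalk ρ hπ hzc hz2 hρz r x hij R T U)

end Limits

section LimitsTorus

open Literature.MathematicalPhysics.QuantumLattice (fundamentalRep unitaryFundamentalRep
  continuous_fundamentalRep continuous_unitaryFundamentalRep)

variable {G : Type} [Group G] [TopologicalSpace G] [IsTopologicalGroup G] [CompactSpace G]
  [MeasurableSpace G] [BorelSpace G] [SecondCountableTopology G]
variable (ρ : G →* Matrix (Fin N) (Fin N) ℂ) {z : G} {π : Fin d → Site d →+ ZMod 2}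

/-- ★★★ **Even-side limit-point Wilson loops at `-β`.** If `μ` is an infinite-volume limit of the
torus Wilson states at `β` along a sequence of even sides, then `ν = μ ∘ T⁻¹` is one at `-β` along the
same sequence and `∫ W_{R×T} dν = (-1)^{RT} ∫ W_{R×T} dμ` for every rectangle in every plane
(`ρ` continuous with `ρ z = -1`). -/
theorem exists_limit_integral_wilsonLoopObs_rectWalk_neg (hπ : IsDualParity (zdUnit d) π)
    (hzc : ∀ g : G, z * g = g * z) (hz2 : z * z = 1) (hρ : Continuous ρ) (hρz : ρ z = -1)
    (r : Fin d) {β : ℝ} {Lk : ℕ → ℕ} (heven : ∀ k, 2 ∣ Lk k + 1) {μ : Measure (LGConfig d G)}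
    (hμ : IsInfiniteVolumeLimitAlong ρ β Lk μ) :
    ∃ ν : Measure (LGConfig d G), IsInfiniteVolumeLimitAlong ρ (-β) Lk ν ∧
      ∀ (x : Site d) (i j : Fin d), i ≠ j → ∀ R T : ℕ,
        ∫ U, wilsonLoopObs (normalisedCharacter N ∘ ρ) (rectWalk x i j R T) U ∂ν =
          (-1 : ℝ) ^ (R * T) * ∫ U, wilsonLoopObs (normalisedCharacter N ∘ ρ) (rectWalk x i j R T) U ∂μ :=
  ⟨_, hμ.map_centralTwist ρ hπ r hρ hzc hz2 hρz heven, fun x _ _ hij R T =>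
    integral_wilsonLoopObs_rectWalk_map_centralTwist ρ hπ hzc hz2 hρ hρz r μ x hij R T⟩

/-- ★★ **The sets of even-side limit-point values of `W_{R×T}` at `β` and at `-β` determine each
other**: `v` is the value `∫ W_{R×T} dν` at some even-side limit `ν` at `-β` (along `Lk`) iff
`(-1)^{RT} v` is the value at some even-side limit at `β` (the twist is a bijection of limit points). -/
theorem limitValues_wilsonLoop_neg (hπ : IsDualParity (zdUnit d) π)
    (hzc : ∀ g : G, z * g = g * z) (hz2 : z * z = 1) (hρ : Continuous ρ) (hρz : ρ z = -1)
    (r : Fin d) (β : ℝ) {Lk : ℕ → ℕ} (heven : ∀ k, 2 ∣ Lk k + 1) (x : Site d) {i j : Fin d}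
    (hij : i ≠ j) (R T : ℕ) (v : ℝ) :
    (∃ ν : Measure (LGConfig d G), IsInfiniteVolumeLimitAlong ρ (-β) Lk ν ∧
        ∫ U, wilsonLoopObs (normalisedCharacter N ∘ ρ) (rectWalk x i j R T) U ∂ν = v) ↔
      ∃ μ : Measure (LGConfig d G), IsInfiniteVolumeLimitAlong ρ β Lk μ ∧
        ∫ U, wilsonLoopObs (normalisedCharacter N ∘ ρ) (rectWalk x i j R T) U ∂μ =
          (-1 : ℝ) ^ (R * T) * v := by
  have hs := isStaggering_stagTwist (G := G) (e := zdUnit d) hπ r hzc hz2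
  have hsq : ((-1 : ℝ) ^ (R * T)) * (-1 : ℝ) ^ (R * T) = 1 := by
    rw [← mul_pow, neg_one_mul, neg_neg, one_pow]
  constructor
  · rintro ⟨ν, hν, hv⟩
    refine ⟨ν.map (centralTwist (stagTwist π r z)), ?_, ?_⟩
    · have h := hν.map_centralTwist ρ hπ r hρ hzc hz2 hρz heven
      rwa [neg_neg] at h
    · rw [integral_wilsonLoopObs_rectWalk_map_centralTwist ρ hπ hzc hz2 hρ hρz r ν x hij R T, hv]
  · rintro ⟨μ, hμ, hv⟩
    refine ⟨μ.map (centralTwist (stagTwist π r z)), hμ.map_centralTwist ρ hπ r hρ hzc hz2 hρz heven, ?_⟩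
    rw [integral_wilsonLoopObs_rectWalk_map_centralTwist ρ hπ hzc hz2 hρ hρz r μ x hij R T, hv,
      ← mul_assoc, hsq, one_mul]

/-- ★★★ **`SU(M)`, `M` even (so `SU(2)`)**: the even-side limit-point values of `W̄(R×T)` at
`-β_tree` are exactly `(-1)^{RT}` times those at `β_tree`, every `d`, every plane. -/
theorem limitValues_wilsonLoop_neg_suEven {M : ℕ} (hM : Even M) {d : ℕ} {π : Fin d → Site d →+ ZMod 2}
    (hπ : IsDualParity (zdUnit d) π) (r : Fin d) (β : ℝ) {Lk : ℕ → ℕ} (heven : ∀ k, 2 ∣ Lk k + 1)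
    (x : Site d) {i j : Fin d} (hij : i ≠ j) (R T : ℕ) (v : ℝ) :
    (∃ ν : Measure (LGConfig d (Matrix.specialUnitaryGroup (Fin M) ℂ)),
        IsInfiniteVolumeLimitAlong (fundamentalRep (Fin M)) (-β) Lk ν ∧
        ∫ U, wilsonLoopObs (normalisedCharacter M ∘ fundamentalRep (Fin M)) (rectWalk x i j R T) U ∂ν = v) ↔
      ∃ μ : Measure (LGConfig d (Matrix.specialUnitaryGroup (Fin M) ℂ)),
        IsInfiniteVolumeLimitAlong (fundamentalRep (Fin M)) β Lk μ ∧
        ∫ U, wilsonLoopObs (normalisedCharacter M ∘ fundamentalRep (Fin M)) (rectWalk x i j R T) U ∂μ =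
          (-1 : ℝ) ^ (R * T) * v :=
  limitValues_wilsonLoop_neg (fundamentalRep (Fin M))
    (z := ⟨-1, neg_one_mem_specialUnitaryGroup_of_even hM⟩) hπ (fun g => Subtype.ext (by simp))
    (Subtype.ext (by simp)) (continuous_fundamentalRep (Fin M)) (by rw [fundamentalRep_apply]) r β heven
    x hij R T v

/-- ★★★ **`U(N)`**: the same for the unitary group in the defining representation. -/
theorem limitValues_wilsonLoop_neg_uN {N d : ℕ} {π : Fin d → Site d →+ ZMod 2}
    (hπ : IsDualParity (zdUnit d) π) (r : Fin d) (β : ℝ) {Lk : ℕ → ℕ} (heven : ∀ k, 2 ∣ Lk k + 1)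
    (x : Site d) {i j : Fin d} (hij : i ≠ j) (R T : ℕ) (v : ℝ) :
    (∃ ν : Measure (LGConfig d (Matrix.unitaryGroup (Fin N) ℂ)),
        IsInfiniteVolumeLimitAlong (unitaryFundamentalRep (Fin N) ℂ) (-β) Lk ν ∧
        ∫ U, wilsonLoopObs (normalisedCharacter N ∘ unitaryFundamentalRep (Fin N) ℂ)
          (rectWalk x i j R T) U ∂ν = v) ↔
      ∃ μ : Measure (LGConfig d (Matrix.unitaryGroup (Fin N) ℂ)),
        IsInfiniteVolumeLimitAlong (unitaryFundamentalRep (Fin N) ℂ) β Lk μ ∧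
        ∫ U, wilsonLoopObs (normalisedCharacter N ∘ unitaryFundamentalRep (Fin N) ℂ)
          (rectWalk x i j R T) U ∂μ = (-1 : ℝ) ^ (R * T) * v :=
  limitValues_wilsonLoop_neg (unitaryFundamentalRep (Fin N) ℂ)
    (z := ⟨-1, by simp [Matrix.mem_unitaryGroup_iff]⟩) hπ (fun g => Subtype.ext (by simp))
    (Subtype.ext (by simp)) (continuous_unitaryFundamentalRep (Fin N) ℂ) rfl r β heven x hij R T v

end LimitsTorus

end TiltedRP

end Summit.QuantumFields.GaugeBoot
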